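import Summits.QuantumFields.YangMills.Theorems.FradkinShenkerFlowClusteringToYangMillsStubCylinderApprox
import Summits.QuantumFields.YangMills.Theorems.FradkinShenkerFlowClusteringToYangMillsStubReconstructibleGeometry
import HarnessLib

/-!
# `stub_admissibleGivesGap`, helper 3/4: gauge transformations on `ℤ⁴` and the gauge average
# over the endpoints of the support

Support file for crux `stmt-QuantumFields-8762`
(`Summit.QuantumFields.YangMills.Theses.EquipartitionCriticality.CriticalContinuumLimit`), line
`Sketch`, stub `stub_admissibleGivesGap` (I0 = RQ of line `spectral-requantisation-dock` of crux
`ClusteringToYangMills`, stmt-QuantumFields-9443): torus clustering at `β` with rate `m` ⟹ every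
odd-torus limit state is OS-reconstructible with transfer gap `≥ m`. The stub is assembled in
`EquipartitionCriticalityCriticalContinuumLimitStubAdmissibleGivesGap.lean` from four helper files
(`…LTwo`, `…TorusRP`, `…Gauge`, `…GaugeInvariance`) and the landed RQ0/RQb2 of 9443.

**This file.** Geometry of `ℤ⁴` gauge transformations (`Θ (U^g) = (Θ U)^{g ∘ θ}`; a cylinder
observable reads `g` only at the endpoints `ends Λ` of its support, all at times `≥ 0` for
positive-time supports, so `F̄ ∘ Θ` is blind to gauge transformations living on `ends Λ`), the
extension by `1` of `γ : ends Λ → G`, and the **gauge average**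
`P F (U) = ∫ F(U^γ) dγ` over the product Haar probability measure of `G^{ends Λ}`: continuous
(dominated convergence), cylinder with the same support, bounded, and gauge invariant (right
invariance of Haar measure; `gaugeAvg_gaugeTransformZd`; the registered name of this file is `admissibleGap_reflect_gaugeTransform`) — a continuous
gauge-invariant species `avgSpecies`.

References: K. Osterwalder, E. Seiler, Ann. Phys. 110 (1978) 440, §2; E. Seiler, LNP 159 (1982)
Ch. 2; J. Glimm, A. Jaffe, *Quantum Physics* (1987) §6.1; J. Fröhlich, R. Israel, E. Lieb,
B. Simon, Comm. Math. Phys. 62 (1978) 1, §2–3.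
-/

noncomputable section

open scoped BigOperators Topology ENNReal ComplexConjugate ComplexOrder
open MeasureTheory Filter
open Literature.MathematicalPhysics Literature.MathematicalPhysics.QuantumFieldTheory
  Literature.MathematicalPhysics.QuantumLattice
open Literature.Probability.LatticeModels (IsOSReconstructible IsBoundedMeasurable positiveEvents osForm)

namespace Summit.QuantumFields.YangMills.Theorems.CriticalContinuumLimit.AdmissibleGap

open Summit.QuantumFields.YangMills.Theorems.ClusteringToYangMills
open Summit.QuantumFields.YangMills.Theorems.ClusteringToYangMills.Reconstructible

section GaugeGeometry

variable {G : Type} [Group G]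

/-- `θ(x + eᵢ) = θ x + eᵢ` for a spatial direction `i ≠ 0`. [folklore] -/
theorem latticeTimeReflection_add_single_of_ne (x : Fin 4 → ℤ) {i : Fin 4} (hi : i ≠ 0) :
    latticeTimeReflection 4 (x + Pi.single i 1) = latticeTimeReflection 4 x + Pi.single i 1 := by
  ext j
  by_cases hj : j = 0
  · subst hj
    simp [latticeTimeReflection_apply, Pi.single_eq_of_ne (Ne.symm hi)]
  · simp [latticeTimeReflection_apply, hj]

-- adapted from Theorems/FradkinShenkerFlowClusteringToYangMillsStubGapFromClustering.lean (private there)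
/-- **`Θ` intertwines gauge transformations**: `Θ (U^g) = (Θ U)^{g ∘ θ}`. [folklore] -/
theorem gaugeTimeReflect_gaugeTransformZd (g : (Fin 4 → ℤ) → G) (U : LGConfig 4 G) :
    gaugeTimeReflect (gaugeTransformZd g U) =
      gaugeTransformZd (g ∘ latticeTimeReflection 4) (gaugeTimeReflect U) := by
  funext e
  obtain ⟨x, i⟩ := e
  by_cases hi : i = 0
  · subst hi
    simp only [gaugeTimeReflect_apply, gaugeTransformZd, if_true, Function.comp_apply,
      latticeTimeReflection_add_add, mul_inv_rev, inv_inv, mul_assoc]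
  · simp only [gaugeTimeReflect_apply, gaugeTransformZd, if_neg hi, Function.comp_apply,
      latticeTimeReflection_add_single_of_ne x hi]

/-- Composition of gauge transformations: `(U^g)^{g'} = U^{g' g}`. [folklore] -/
theorem gaugeTransformZd_gaugeTransformZd (g g' : (Fin 4 → ℤ) → G) (U : LGConfig 4 G) :
    gaugeTransformZd g' (gaugeTransformZd g U) = gaugeTransformZd (g' * g) U := by
  funext e
  simp only [gaugeTransformZd, Pi.mul_apply, mul_inv_rev, mul_assoc]

/-- A cylinder observable reads a gauge transformation only through its values at the endpoints
of the links of its support. [folklore] -/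
theorem apply_gaugeTransformZd_congr {α : Type*} {F : LGConfig 4 G → α} {Λ : Finset (QuantumLattice.ZdEdge 4)}
    (hF : IsCylinder F Λ) {g₁ g₂ : (Fin 4 → ℤ) → G}
    (h : ∀ e ∈ Λ, g₁ e.1 = g₂ e.1 ∧ g₁ (e.1 + Pi.single e.2 1) = g₂ (e.1 + Pi.single e.2 1))
    (U : LGConfig 4 G) : F (gaugeTransformZd g₁ U) = F (gaugeTransformZd g₂ U) := by
  refine hF fun e he => ?_
  obtain ⟨h1, h2⟩ := h e (Finset.mem_coe.1 he)
  simp only [gaugeTransformZd, h1, h2]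

/-- A gauge transformation trivial at the endpoints of the support is invisible. [folklore] -/
theorem apply_gaugeTransformZd_of_eq_one {α : Type*} {F : LGConfig 4 G → α} {Λ : Finset (QuantumLattice.ZdEdge 4)}
    (hF : IsCylinder F Λ) {g : (Fin 4 → ℤ) → G}
    (h : ∀ e ∈ Λ, g e.1 = 1 ∧ g (e.1 + Pi.single e.2 1) = 1) (U : LGConfig 4 G) :
    F (gaugeTransformZd g U) = F U := by
  have h1 : F (gaugeTransformZd g U) = F (gaugeTransformZd 1 U) :=
    apply_gaugeTransformZd_congr hF (fun e he => by simpa using h e he) U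
  rw [h1]
  congr 1
  funext e
  simp [gaugeTransformZd]

/-- Gauge transforms of cylinder observables are cylinder observables (same support). [folklore] -/
theorem isCylinder_comp_gaugeTransformZd {α : Type*} {F : LGConfig 4 G → α} {Λ : Finset (QuantumLattice.ZdEdge 4)}
    (hF : IsCylinder F Λ) (g : (Fin 4 → ℤ) → G) : IsCylinder (fun U => F (gaugeTransformZd g U)) Λ := by
  intro U V hUV
  refine hF fun e he => ?_
  simp only [gaugeTransformZd, hUV e he]

/-- Gauge transformations are continuous. [folklore] -/
theorem continuous_gaugeTransformZd [TopologicalSpace G] [IsTopologicalGroup G] (g : (Fin 4 → ℤ) → G) :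
    Continuous (gaugeTransformZd g : LGConfig 4 G → LGConfig 4 G) :=
  continuous_pi fun e => (continuous_const.mul (continuous_apply e)).mul continuous_const

/-- Gauge transformations are measurable. [folklore] -/
theorem measurable_gaugeTransformZd [MeasurableSpace G] [MeasurableMul G] (g : (Fin 4 → ℤ) → G) :
    Measurable (gaugeTransformZd g : LGConfig 4 G → LGConfig 4 G) :=
  measurable_pi_lambda _ fun e => by
    simp only [gaugeTransformZd]
    have hm : Measurable fun U : LGConfig 4 G => U e := measurable_pi_apply e
    exact (hm.const_mul (g e.1)).mul_const _

/-- The endpoints of a finite set of links. [folklore] -/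
def ends (Λ : Finset (QuantumLattice.ZdEdge 4)) : Finset (Fin 4 → ℤ) :=
  Λ.image (fun e => e.1) ∪ Λ.image (fun e => e.1 + Pi.single e.2 1)

/-- Base points are endpoints. [folklore] -/
theorem fst_mem_ends {Λ : Finset (QuantumLattice.ZdEdge 4)} {e : QuantumLattice.ZdEdge 4} (he : e ∈ Λ) : e.1 ∈ ends Λ :=
  Finset.mem_union_left _ (Finset.mem_image_of_mem _ he)

/-- Tips are endpoints. [folklore] -/
theorem tip_mem_ends {Λ : Finset (QuantumLattice.ZdEdge 4)} {e : QuantumLattice.ZdEdge 4} (he : e ∈ Λ) : e.1 + Pi.single e.2 1 ∈ ends Λ :=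
  Finset.mem_union_right _ (Finset.mem_image_of_mem (fun e : QuantumLattice.ZdEdge 4 => e.1 + Pi.single e.2 1) he)

/-- Endpoints of positive-time links have non-negative time. [folklore] -/
theorem time_nonneg_of_mem_ends {Λ : Finset (QuantumLattice.ZdEdge 4)} (hΛ : (↑Λ : Set (QuantumLattice.ZdEdge 4)) ⊆ posTimeEdges)
    {x : Fin 4 → ℤ} (hx : x ∈ ends Λ) : 0 ≤ x 0 := by
  simp only [ends, Finset.mem_union, Finset.mem_image] at hx
  rcases hx with ⟨e, he, rfl⟩ | ⟨e, he, rfl⟩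
  · exact hΛ (Finset.mem_coe.2 he)
  · have h0 : 0 ≤ e.1 0 := hΛ (Finset.mem_coe.2 he)
    have h1 : 0 ≤ (Pi.single e.2 (1 : ℤ) : Fin 4 → ℤ) 0 := by
      by_cases h : (0 : Fin 4) = e.2
      · rw [h, Pi.single_eq_same]; exact zero_le_one
      · rw [Pi.single_eq_of_ne h]
    simpa only [Pi.add_apply] using add_nonneg h0 h1

/-- Extension by `1` of a gauge transformation given on a finite set of sites. [folklore] -/
def extOne (B : Finset (Fin 4 → ℤ)) (γ : ↥B → G) : (Fin 4 → ℤ) → G := fun x => if hx : x ∈ B then γ ⟨x, hx⟩ else 1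

/-- `extOne` on the set. [folklore] -/
theorem extOne_apply_mem {B : Finset (Fin 4 → ℤ)} (γ : ↥B → G) {x : Fin 4 → ℤ} (hx : x ∈ B) :
    extOne B γ x = γ ⟨x, hx⟩ := by
  simp [extOne, hx]

/-- `extOne` off the set. [folklore] -/
theorem extOne_apply_not_mem {B : Finset (Fin 4 → ℤ)} (γ : ↥B → G) {x : Fin 4 → ℤ} (hx : x ∉ B) :
    extOne B γ x = 1 := by
  simp [extOne, hx]

/-- `extOne` is continuous in the group element, pointwise. [folklore] -/
theorem continuous_extOne_apply [TopologicalSpace G] (B : Finset (Fin 4 → ℤ)) (x : Fin 4 → ℤ) :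
    Continuous fun γ : ↥B → G => extOne B γ x := by
  by_cases hx : x ∈ B
  · simp only [extOne, hx, dif_pos]
    exact continuous_apply _
  · simp only [extOne, hx, dif_neg, not_false_eq_true]
    exact continuous_const

/-- Joint continuity of `(γ, U) ↦ U^{extOne γ}`. [folklore] -/
theorem continuous_gaugeTransformZd_extOne [TopologicalSpace G] [IsTopologicalGroup G]
    (B : Finset (Fin 4 → ℤ)) :
    Continuous fun p : (↥B → G) × LGConfig 4 G => gaugeTransformZd (extOne B p.1) p.2 :=
  continuous_pi fun e => by
    simp only [gaugeTransformZd]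
    have hc : Continuous fun p : (↥B → G) × LGConfig 4 G => p.2 e :=
      (continuous_apply e).comp continuous_snd
    exact (((continuous_extOne_apply B e.1).comp continuous_fst).mul hc).mul
      ((continuous_extOne_apply B (e.1 + Pi.single e.2 1)).comp continuous_fst).inv

end GaugeGeometry

/-! ### The gauge average over the endpoints of the support -/

section GaugeAverage

variable {G : Type} [Group G] [TopologicalSpace G] [IsTopologicalGroup G] [CompactSpace G]
  [MeasurableSpace G] [BorelSpace G] [SecondCountableTopology G]

/-- Product Haar probability measure on the gauge group `G^B` of a finite set of sites. [folklore] -/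
def haarPi (B : Finset (Fin 4 → ℤ)) : Measure (↥B → G) := Measure.pi fun _ => haarProbability G

/-- `haarPi B` is a probability measure. [folklore] -/
instance instIsProbabilityMeasureHaarPi (B : Finset (Fin 4 → ℤ)) :
    IsProbabilityMeasure (haarPi (G := G) B) := by
  unfold haarPi; infer_instance

/-- `haarPi B` is right invariant (compact groups are unimodular). [folklore] -/
instance instIsMulRightInvariantHaarPi (B : Finset (Fin 4 → ℤ)) :
    (haarPi (G := G) B).IsMulRightInvariant := by
  unfold haarPi; infer_instance

/-- **The gauge average** `P F (U) = ∫ F(U^{γ}) dγ` over the gauge group of the finite site set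
`B` (Haar probability measure), `γ` extended by `1`. [folklore] -/
def gaugeAvg {E : Type*} [NormedAddCommGroup E] [NormedSpace ℝ E] (B : Finset (Fin 4 → ℤ))
    (F : LGConfig 4 G → E) (U : LGConfig 4 G) : E :=
  ∫ γ, F (gaugeTransformZd (extOne B γ) U) ∂(haarPi B)

variable {E : Type*} [NormedAddCommGroup E] [NormedSpace ℝ E]

/-- The gauge average of a bounded continuous observable is continuous (dominated convergence).
[folklore] -/
theorem continuous_gaugeAvg (B : Finset (Fin 4 → ℤ)) {F : LGConfig 4 G → E} (hFc : Continuous F)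
    {C : ℝ} (hC : ∀ U, ‖F U‖ ≤ C) : Continuous (gaugeAvg B F) := by
  refine continuous_of_dominated (F := fun U γ => F (gaugeTransformZd (extOne B γ) U))
    (bound := fun _ => C) (fun U => ?_) (fun U => ae_of_all _ fun γ => hC _) (integrable_const C)
    (ae_of_all _ fun γ => hFc.comp (continuous_gaugeTransformZd _))
  exact (hFc.comp ((continuous_gaugeTransformZd_extOne B).comp
    (continuous_id.prodMk continuous_const))).aestronglyMeasurable

omit [SecondCountableTopology G] in
/-- The gauge average keeps the sup-norm bound. [folklore] -/
theorem norm_gaugeAvg_le (B : Finset (Fin 4 → ℤ)) {F : LGConfig 4 G → E} {C : ℝ} (hC : ∀ U, ‖F U‖ ≤ C)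
    (U : LGConfig 4 G) : ‖gaugeAvg B F U‖ ≤ C := by
  refine (norm_integral_le_of_norm_le_const (ae_of_all _ fun γ => hC _)).trans ?_
  simp

omit [SecondCountableTopology G] in
/-- The gauge average of a cylinder observable is a cylinder observable (same support). [folklore] -/
theorem isCylinder_gaugeAvg (B : Finset (Fin 4 → ℤ)) {F : LGConfig 4 G → E} {Λ : Finset (QuantumLattice.ZdEdge 4)}
    (hF : IsCylinder F Λ) : IsCylinder (gaugeAvg B F) Λ := by
  intro U V hUV
  simp only [gaugeAvg]
  exact integral_congr_ae (ae_of_all _ fun γ => isCylinder_comp_gaugeTransformZd hF _ hUV)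

omit [SecondCountableTopology G] in
/-- **The gauge average over the endpoints of the support is gauge invariant** (right invariance
of Haar measure on `G^B`). [folklore] -/
theorem gaugeAvg_gaugeTransformZd {F : LGConfig 4 G → E} {Λ : Finset (QuantumLattice.ZdEdge 4)} (hF : IsCylinder F Λ)
    (g : (Fin 4 → ℤ) → G) (U : LGConfig 4 G) :
    gaugeAvg (ends Λ) F (gaugeTransformZd g U) = gaugeAvg (ends Λ) F U := by
  simp only [gaugeAvg, gaugeTransformZd_gaugeTransformZd]
  set c : ↥(ends Λ) → G := fun x => g x.1 with hc
  have hpt : ∀ γ : ↥(ends Λ) → G, F (gaugeTransformZd (extOne (ends Λ) γ * g) U) =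
      F (gaugeTransformZd (extOne (ends Λ) (γ * c)) U) := by
    intro γ
    refine apply_gaugeTransformZd_congr hF (fun e he => ⟨?_, ?_⟩) U
    · simp only [Pi.mul_apply, extOne_apply_mem _ (fst_mem_ends he), hc]
    · simp only [Pi.mul_apply, extOne_apply_mem _ (tip_mem_ends he), hc]
  simp_rw [hpt]
  exact integral_mul_right_eq_self (fun γ => F (gaugeTransformZd (extOne (ends Λ) γ) U)) c

omit [SecondCountableTopology G] in
/-- The complex gauge average of a real observable is the real gauge average. [folklore] -/
theorem gaugeAvg_ofReal (B : Finset (Fin 4 → ℤ)) (F : LGConfig 4 G → ℝ) (U : LGConfig 4 G) :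
    gaugeAvg B (fun U => (F U : ℂ)) U = ((gaugeAvg B F U : ℝ) : ℂ) := by
  simp only [gaugeAvg]
  exact integral_ofReal

/-- **The gauge-averaged species** of a bounded continuous real cylinder observable. [folklore] -/
def avgSpecies (F : LGConfig 4 G → ℝ) (Λ : Finset (QuantumLattice.ZdEdge 4)) (hF : IsCylinder F Λ) (hFc : Continuous F)
    (C : ℝ) (hC : ∀ U, |F U| ≤ C) : YMSpecies G where
  F := gaugeAvg (ends Λ) F
  supp := Λ
  isCylinder := isCylinder_gaugeAvg _ hF
  gaugeInvariant := fun g U => gaugeAvg_gaugeTransformZd hF g U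
  bounded := ⟨C, fun U => by
    have h := norm_gaugeAvg_le (ends Λ) (F := F) (C := C)
      (fun U => by rw [Real.norm_eq_abs]; exact hC U) U
    rwa [Real.norm_eq_abs] at h⟩
  measurable := (continuous_gaugeAvg (ends Λ) hFc (C := C)
    (fun U => by rw [Real.norm_eq_abs]; exact hC U)).measurable

/-- The observable of the gauge-averaged species. [folklore] -/
@[simp] theorem avgSpecies_F (F : LGConfig 4 G → ℝ) (Λ : Finset (QuantumLattice.ZdEdge 4)) (hF : IsCylinder F Λ)
    (hFc : Continuous F) (C : ℝ) (hC : ∀ U, |F U| ≤ C) :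
    (avgSpecies F Λ hF hFc C hC).F = gaugeAvg (ends Λ) F := rfl

end GaugeAverage

/-! ### The OS image of a continuous positive-time cylinder observable is that of its gauge average -/

section OSImage

variable {G : Type} [Group G] [TopologicalSpace G] [IsTopologicalGroup G] [CompactSpace G]
  [MeasurableSpace G] [BorelSpace G]

omit [TopologicalSpace G] [IsTopologicalGroup G] [CompactSpace G] [BorelSpace G] in
/-- A measurable cylinder observable supported on positive-time links is `𝓔₊`-measurable (it
factors through the padding of the positive-time coordinates). [folklore] -/
theorem measurable_posTime_of_isCylinder {α : Type*} [MeasurableSpace α] {F : LGConfig 4 G → α}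
    {Λ : Finset (QuantumLattice.ZdEdge 4)} (hF : IsCylinder F Λ) (hΛ : (↑Λ : Set (QuantumLattice.ZdEdge 4)) ⊆ posTimeEdges)
    (hFm : Measurable F) : Measurable[posTimeEvents G] F := by
  classical
  have hpad : Measurable[posTimeEvents G]
      (fun (U : LGConfig 4 G) e => if e ∈ Λ then U e else (1 : G)) := by
    refine @measurable_pi_lambda _ _ _ (posTimeEvents G) _ _ fun e => ?_
    by_cases he : e ∈ Λ
    · simp only [he, if_true]
      exact measurable_cylinderEvent_apply (hΛ (Finset.mem_coe.2 he))
    · simp only [he, if_false]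
      exact measurable_const
  have hfac : F = F ∘ fun (U : LGConfig 4 G) e => if e ∈ Λ then U e else 1 :=
    funext fun U => hF fun e he => by simp only [if_pos (Finset.mem_coe.1 he)]
  rw [hfac]
  exact hFm.comp hpad

omit [TopologicalSpace G] [IsTopologicalGroup G] [CompactSpace G] [MeasurableSpace G] [BorelSpace G] in
/-- **The reflected half does not see gauge transformations at non-negative times**: for a
cylinder observable `D` supported on positive-time links and `γ` living on the endpoints of such
links, `D (Θ (U^{γ})) = D (Θ U)`. [folklore] -/
theorem apply_gaugeTimeReflect_gaugeTransformZd_extOne {α : Type*} {D : LGConfig 4 G → α}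
    {Λ Λ' : Finset (QuantumLattice.ZdEdge 4)} (hD : IsCylinder D Λ) (hΛ : (↑Λ : Set (QuantumLattice.ZdEdge 4)) ⊆ posTimeEdges)
    (hΛ' : (↑Λ' : Set (QuantumLattice.ZdEdge 4)) ⊆ posTimeEdges) (γ : ↥(ends Λ') → G) (U : LGConfig 4 G) :
    D (gaugeTimeReflect (gaugeTransformZd (extOne (ends Λ') γ) U)) = D (gaugeTimeReflect U) := by
  rw [gaugeTimeReflect_gaugeTransformZd]
  refine apply_gaugeTransformZd_of_eq_one hD (fun e he => ⟨?_, ?_⟩) _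
  · refine extOne_apply_not_mem γ fun hx => ?_
    have h1 := time_nonneg_of_mem_ends hΛ' hx
    have h2 := time_nonneg_of_mem_ends hΛ (fst_mem_ends he)
    simp only [latticeTimeReflection_apply, Function.update_self] at h1
    omega
  · refine extOne_apply_not_mem γ fun hx => ?_
    have h1 := time_nonneg_of_mem_ends hΛ' hx
    have h2 := time_nonneg_of_mem_ends hΛ (tip_mem_ends he)
    simp only [latticeTimeReflection_apply, Function.update_self] at h1
    omega

variable [SecondCountableTopology G]

omit [IsTopologicalGroup G] [CompactSpace G] in
/-- Bounded continuous cylinder observables supported on positive-time links are bounded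
`𝓔₊`-measurable. [folklore] -/
theorem isBoundedMeasurable_of_continuous {F : LGConfig 4 G → ℂ} {Λ : Finset (QuantumLattice.ZdEdge 4)}
    (hF : IsCylinder F Λ) (hΛ : (↑Λ : Set (QuantumLattice.ZdEdge 4)) ⊆ posTimeEdges) (hFc : Continuous F) {C : ℝ}
    (hC : ∀ U, ‖F U‖ ≤ C) : IsBoundedMeasurable (posTimeEvents G) F :=
  ⟨measurable_posTime_of_isCylinder hF hΛ hFc.measurable, C, hC⟩

end OSImage

end Summit.QuantumFields.YangMills.Theorems.CriticalContinuumLimit.AdmissibleGap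

namespace Summit.QuantumFields.YangMills.Theorems.CriticalContinuumLimit

/-- **Registered helper `admissibleGap_reflect_gaugeTransform`** (stub `stub_admissibleGivesGap`,
helper 3/4): the bond time reflection intertwines gauge transformations, `Θ (U^g) = (Θ U)^{g ∘ θ}`
(so the reflected half is blind to gauge transformations at non-negative times). The file's main
content is the gauge average `AdmissibleGap.gaugeAvg` / `AdmissibleGap.avgSpecies` and its gauge
invariance `AdmissibleGap.gaugeAvg_gaugeTransformZd`. [folklore] -/
theorem admissibleGap_reflect_gaugeTransform (G : Type) [Group G]
    (g : Literature.Probability.LatticeModels.Site 4 → G) (U : LGConfig 4 G) :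
    gaugeTimeReflect (gaugeTransformZd g U) =
      gaugeTransformZd (g ∘ latticeTimeReflection 4) (gaugeTimeReflect U) :=
  AdmissibleGap.gaugeTimeReflect_gaugeTransformZd g U

end Summit.QuantumFields.YangMills.Theorems.CriticalContinuumLimit

end
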